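import Summits.QuantumFields.YangMills.Theorems.BalabanUVNodesN15KingModelCurvedHTorusProp38MassUniform
import Literature.MathematicalPhysics.QuantumFieldTheory.King1986.SlicePropagatorStatementsAt

/-!
# BalabanUVNodes ∕ N15 — THE KING-MODEL RUNG, PART 54: KING's PROPOSITION 3.8 (3.71) BY NAME — the literature schema
# `King1986.SlicePropagator.Prop38PrintedAt α` ∕ `Prop38KingOrder` (lit-balaban leaf `King1986/SlicePropagatorStatementsAt`) INHABITED by King's
# ACTUAL `A = 0` minimisers on Bałaban's volumes (Track A, DAG node N15 = NE2, row s3 «King-model rung»; key K3⁸ `SpineGivenEndpointR13SepCoPHV`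
# stmt-QuantumFields-27366 (KEY MAP v2), helper; the by-name closure of PARTS 51–53)

HONEST FRAMING.  Count-neutral kernel bookkeeping (`--kind proof --supports stmt-QuantumFields-27366 --as helper`; cell `pub-ymgap`, seat
`pub-ymgap-dag-n15-d` g16).  King's `A = 0` SCALAR MODEL ([King1986], TEMPLATE literature, printed AND kernel-proved on Bałaban's tori); PARTS 51–53
(`…CurvedHTorusHolder` p627764, `…CurvedHTorusProp38` p628279, `…Prop38MassUniform` p630124) proved all four lines of (3.71) for the point-distance datum
`kingTwoSpacingH` at every fixed Hölder exponent against THIS SEAT's mirror predicate `N15.KingModel.Prop38PrintedAt`; the literature cell has since typed the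
same text as `SlicePropagator.Prop38PrintedAt` together with the print-order schema `Prop38KingOrder` («for 0 < α < 1, and γ sufficiently small», p. 664)
in the leaf `King1986/SlicePropagatorStatementsAt` (typer g47, 2026-08-28).  This file is the BY-NAME transfer: the two predicates agree definitionally, and King's
`A = 0` data inhabit `Prop38PrintedAt α` (uniformly over volumes ∕ levels ∕ spacing ratios, and over masses under a cap) and `Prop38KingOrder` (per datum).
NOT [Ba 4] at `A ≠ 0`, NOT Bałaban's covariant `H_k(U)` (NE2⁺ NOT PRINTED, not proved); the family-uniform `Prop38Printed` (α inside) is NOT claimed (see PART 52's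
header); NOT a node discharge; K3⁸ OPEN, not claimed; counts UNMOVED (typed 28∕28 · discharged 5∕27, A 5∕28); finite tori — nothing continuum ∕ ℝ⁴ ∕ OS ∕
mass-gap ∕ Clay.  THEOREMS ONLY: 0 `def`, 0 `sorry`, standard axioms.

WHAT.
* `prop38PrintedAt_iff_literature` — `SlicePropagator.Prop38PrintedAt α T C δ₀ γ ↔ N15.KingModel.Prop38PrintedAt α T C δ₀ γ` (`Iff.rfl`: same text).
* ★ `slicePropagator_prop38PrintedAt_kingTwoSpacingH` ∕ ★ `…_unif` — PART 52's ∕ PART 53's inhabitants read on the literature predicate: for every `0 < α < 1` ONE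
  `(C, δ₀, γ > 0)` with `SlicePropagator.Prop38PrintedAt α (kingTwoSpacingH L a m² j n) C δ₀ γ` for every `j`, `n ≥ 1` (resp. also every `0 < m² ≤ m₀²`).
* ★★ `prop38KingOrder_kingTwoSpacingH` — **`SlicePropagator.Prop38KingOrder (kingTwoSpacingH L a m² j n)` for EVERY volume∕scale index `j` and EVERY `n ≥ 1`**:
  King's Proposition 3.8, in King's quantifier order, BY NAME, for King's actual `A = 0` minimisers (odd `L ≥ 3`, `a, m² > 0`).
Locators: [King1986] C. King, CMP **102** (1986) 649–677: Prop. 3.8 (3.71) p. 664 («for 0 < α < 1, and γ sufficiently small»), (3.62) p. 663, §4 pp. 673–674.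
-/

noncomputable section

namespace Summit.QuantumFields.YangMills.BalabanUVNodes.N15.KingModel

open Literature.MathematicalPhysics.QuantumFieldTheory.King1986.SlicePropagator (TwoSpacing Prop38KingOrder)
open Summit.QuantumFields.YangMills.BalabanUVNodes.N15KingModelRung (KingVolIndex)

variable {d : ℕ}

/-- **THE TWO MIRRORS AGREE**: the literature cell's `SlicePropagator.Prop38PrintedAt α T C δ₀ γ` (`King1986/SlicePropagatorStatementsAt` §1) and this
seat's `N15.KingModel.Prop38PrintedAt α T C δ₀ γ` (PART 52) are the same text — definitionally equal. [cite: King1986, Prop. 3.8 (3.71) p.664] -/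
theorem prop38PrintedAt_iff_literature (α : ℝ) (T : TwoSpacing d) (C δ₀ γ : ℝ) :
    Literature.MathematicalPhysics.QuantumFieldTheory.King1986.SlicePropagator.Prop38PrintedAt α T C δ₀ γ ↔ Prop38PrintedAt α T C δ₀ γ :=
  Iff.rfl

variable (L : ℕ) [NeZero L]

/-- ★ **(3.71) AT A FIXED HÖLDER EXPONENT, ON THE LITERATURE PREDICATE, FOR KING's `A = 0` DATA — UNIFORMLY** (odd `L ≥ 3`, `a, m² > 0`, `0 < α < 1`):
ONE `(C, δ₀, γ > 0)` (`γ = (1 − α)∕4`) with `SlicePropagator.Prop38PrintedAt α (kingTwoSpacingH L a m² j n) C δ₀ γ` for EVERY `j` and EVERY `n ≥ 1` — PART 52's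
`prop38PrintedAt_kingTwoSpacingH` by name. [cite: King1986, Prop. 3.8 (3.71) p.664, §4 pp.673–674] -/
theorem slicePropagator_prop38PrintedAt_kingTwoSpacingH (hLodd : Odd L) (hL : 2 ≤ L) {a m2 : ℝ} (ha : 0 < a) (hm : 0 < m2) {α : ℝ}
    (hα0 : 0 < α) (hα1 : α < 1) :
    ∃ C δ₀ γ : ℝ, 0 < C ∧ 0 < δ₀ ∧ 0 < γ ∧ ∀ (j : KingVolIndex d) (n : ℕ) (_hn : 1 ≤ n),
      Literature.MathematicalPhysics.QuantumFieldTheory.King1986.SlicePropagator.Prop38PrintedAt α (kingTwoSpacingH L a m2 j n) C δ₀ γ :=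
  prop38PrintedAt_kingTwoSpacingH (d := d) L hLodd hL ha hm hα0 hα1

/-- ★ **The same with the constants UNIFORM IN THE MASS `0 < m² ≤ m₀²`** — PART 53's `prop38PrintedAt_kingTwoSpacingH_unif` by name (King (2.20): the slice of
scale `j` carries `m²(L^jη)² ≤ m²`). [cite: King1986, Prop. 3.8 (3.71) p.664, (2.20) p.654] -/
theorem slicePropagator_prop38PrintedAt_kingTwoSpacingH_unif (hLodd : Odd L) (hL : 2 ≤ L) {a : ℝ} (ha : 0 < a) {m0sq : ℝ} (hm0 : 0 ≤ m0sq)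
    {α : ℝ} (hα0 : 0 < α) (hα1 : α < 1) :
    ∃ C δ₀ γ : ℝ, 0 < C ∧ 0 < δ₀ ∧ 0 < γ ∧ ∀ (m2 : ℝ) (_hm : 0 < m2) (_hcap : m2 ≤ m0sq) (j : KingVolIndex d) (n : ℕ) (_hn : 1 ≤ n),
      Literature.MathematicalPhysics.QuantumFieldTheory.King1986.SlicePropagator.Prop38PrintedAt α (kingTwoSpacingH L a m2 j n) C δ₀ γ :=
  prop38PrintedAt_kingTwoSpacingH_unif (d := d) L hLodd hL ha hm0 hα0 hα1

/-- ★★ **KING's PROPOSITION 3.8, IN KING's QUANTIFIER ORDER, BY NAME, FOR KING's ACTUAL `A = 0` MINIMISERS**: for odd `L ≥ 3`, `a > 0`, `m² > 0`, EVERY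
volume∕scale index `j` (unit torus `2L^m`, `K ≥ 1` coarse scales) and EVERY `n ≥ 1` extra scales, the literature schema
`SlicePropagator.Prop38KingOrder (kingTwoSpacingH L a m² j n)` holds: «for 0 < α < 1, and γ sufficiently small» there are `C, δ₀, γ > 0` with all four lines
of (3.71) for `ℋ_K`, `ℋ_{K+n}` (point distance, unit sites, King's pairing).  The constants produced do NOT depend on `j, n` (`slicePropagator_prop38PrintedAt_kingTwoSpacingH`);
the schema's per-datum `∃` forgets that uniformity.  King's `A = 0` MODEL — NOT [Ba 4] at `A ≠ 0`, NOT Bałaban's `H_k(U)`. [cite: King1986, Prop. 3.8 (3.71) p.664] -/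
theorem prop38KingOrder_kingTwoSpacingH (hLodd : Odd L) (hL : 2 ≤ L) {a m2 : ℝ} (ha : 0 < a) (hm : 0 < m2) (j : KingVolIndex d) (n : ℕ)
    (hn : 1 ≤ n) : Prop38KingOrder (kingTwoSpacingH L a m2 j n) := by
  intro α hα0 hα1
  obtain ⟨C, δ₀, γ, _, _, hγ, H⟩ := slicePropagator_prop38PrintedAt_kingTwoSpacingH (d := d) L hLodd hL ha hm hα0 hα1
  exact ⟨C, δ₀, γ, hγ, H j n hn⟩

/-- The print-order schema holds on a non-empty family of genuine two-spacing pairs (every `n ≥ 1` over every volume with `K ≥ 1`): the by-name inhabitant is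
not void. [folklore] -/
theorem exists_prop38KingOrder_kingTwoSpacingH (hLodd : Odd L) (hL : 2 ≤ L) {a m2 : ℝ} (ha : 0 < a) (hm : 0 < m2) :
    ∃ (j : KingVolIndex d) (n : ℕ), 1 ≤ n ∧ Prop38KingOrder (kingTwoSpacingH L a m2 j n) :=
  ⟨⟨0, 1, le_rfl, 1, le_rfl⟩, 1, le_rfl, prop38KingOrder_kingTwoSpacingH (d := d) L hLodd hL ha hm _ 1 le_rfl⟩

end Summit.QuantumFields.YangMills.BalabanUVNodes.N15.KingModel

end
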